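import Summits.BirchSwinnertonDyer.BirchSwinnertonDyer.Theorems.KolyvaginRoadThreeMethod2LocalDictionaries
import Summits.BirchSwinnertonDyer.BirchSwinnertonDyer.Theorems.KolyvaginRoadThreeZhangSupplySigned
import HarnessLib

/-!
# Route `KolyvaginRoadThree`, deciding crux `ZhangSharpFrameAtThreeHL` (item stmt-BirchSwinnertonDyer-19574):
# the SIGNED supply (Zhang 2014 Lemma 8.2 ∕ McCallum 1991 Lemma 5.3) FROM THE UNSIGNED JUMP — the (Supply) binder
# `hSupply` of the S2-ENGINE capstone `Method2.inductionOfLevelSystems_of_localGlobal` (zhang3-p1 g8, p502470)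
# reduced to (J) an unsigned Poitou–Tate count, (Stab) conjugation-stability of the relaxed group and (IsoBound) a
# purely local statement at one Kolyvagin prime
# (cell `bsd-stepL`, ACCEL seat `bsd-stepL-koly3b` g5; `--supports stmt-BirchSwinnertonDyer-19574`, helper; part IX
# of the `KolyvaginRoadThreeZhangSupply*` series)

HONEST FRAMING. Two theorems; 0 definitions, 0 named facts, 0 `sorry`; the second is CONDITIONAL on every binder;
nothing about BSD, Heegner points or level raising is asserted; closes nothing (T7). PARTITION: O2@3 (B10) × A1 × crux
19574 × the S2-ENGINE's (Supply) binder — proves-glue.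

WHY A NEW ROUTE. Part V (`KolyvaginRoadThreeZhangSupplySigned`) obtains the signed supply by COUNTING inside an
eigenspace, which needs (E2) the invariance of the summed local pairings under complex conjugation, (E3) the signed
local half-sizes at a Kolyvagin prime and (E4) `Weil ∘ τ = τ ∘ Weil` (SUPPLY-INTERFACE-19574.md §4). The present route
needs none of them. Fix a good non-empty level `n`, a Kolyvagin prime `ℓ` with place `λ`, a finite set `T ∌ ℓ` of
Kolyvagin primes and let `G = H¹_{𝓕ⁿ_T, λ-relaxed}(K, E[3])` be the group of classes satisfying the level-`n`
conditions off `T ∪ {λ}` (E's Kummer condition at the infinite places and above no prime of `n`, ORDINARY above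
`n`), TRANSVERSE at `T`, and NO condition at `λ` — the group whose `±`-parts the binder `hSupply` asks to be
non-zero. Then:

* `loc_λ(G)` is ISOTROPIC for the local pairing `b_λ` (reciprocity `hrec` + isotropy of the Kummer ∕ ordinary ∕
  transverse conditions — binders the capstone already has);
* (Stab) `G` is stable under `conjAct c` (`c` complex conjugation, `c² = 1`), so every `x ∈ G` is `x⁺ + x⁻` with
  `x^± ∈ G^±` (part V `exists_eigen_decomposition`, `3` odd), whence `loc_λ(G) = loc_λ(G⁺) + loc_λ(G⁻)`;
* (IsoBound_s) «two mutually `b_λ`-isotropic localisations of sign-`s` classes are proportional» — in each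
  `τ`-eigenplane `H¹(K_λ, E[3])^s = H¹_f^s ⊕ H¹_tr^s` (two isotropic lines in perfect duality, Gross 1991 Prop. 8.1,
  McCallum 1991 L.5.3 first clause, W. Zhang 2014 §8.1) the only isotropic subspaces are `0` and the two lines, so
  `loc_λ(G^s)` is `0` or a LINE;
* (J) `loc_λ(G)` is not contained in a line (it is the 2-dimensional Lagrangian image of the relaxed Selmer group of a
  self-dual structure: Poitou–Tate, Milne I Thm. 4.10 ∕ Howard Thm. 2.1.11 — McCallum Prop. 2.1 is «dimension ≥ 1»,
  the self-dual count gives «= 2»);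

hence BOTH `loc_λ(G⁺)` and `loc_λ(G⁻)` are non-zero lines: for each sign there is `x ∈ G^s` with `loc_λ x ≠ 0`, in
particular `x ≠ 0` — the binder `hSupply` VERBATIM (`supply_signed_of_jump`). §1 is the underlying lemma of additive
group theory (`exists_eigen_not_mem_of_jump`: a subgroup `Z` — here `ker loc_λ = torsionLocalKer_λ` — predicates
`InG`, `E s`, `orth`).

WHAT REMAINS for the capstone's (Supply) after this file: (J) — an UNSIGNED statement, from the four-conjunct fact
`poitouTate_selmerStructure_duality` and the Lagrangian property of the level-`n` local conditions (parts I–IV did the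
«≥ 1» half); (Stab) — Kummer transport is the tree's `conjAct_mem_selmerLocalKer_iff`, ordinary transport is part
VIII `conjAct_mem_ordinaryLocalKer_adicCompletion_iff`, the transverse transport is to do; (IsoBound) — local, from
the same evaluation picture at `λ` (`exists_frobeniusLift_of_isKolyvaginPrime`, `torsionMap_h1Eval_inertia_eq_neg`)
that the capstone's `hperf` ∕ `hline` need anyway.

References: [cite: WZhang2014, §8.1, Lemma 8.2] [cite: McCallumLMS1991, Prop. 2.1 (p. 296), Lemma 5.3 with proof
(p. 303)] [cite: GrossLMS1991, §5 (5.1), Prop. 8.1] [cite: MilneADT2006, Ch. I, Thm. 4.10] [cite: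
Howard2004HeegnerKolyvagin, Thm. 2.1.11].
-/

noncomputable section

open scoped Classical

namespace Summit.BirchSwinnertonDyer.Rank1Residual.X11b.Three.Koly.ZhangSupply

/-! ## §1 The additive-group lemma: an eigen-decomposable subgroup whose image is isotropic but not a line has
both eigen-parts visible -/

/-- **Both signs are seen at `λ` when the image is not a line.** Abstract form: `H` an additive group, `Z ≤ H` (the
classes vanishing at `λ`), predicates `InG` (the relaxed group), `E s` (the two eigenspaces), `orth` (orthogonality of
the localisations at `λ`). If (dec) every member of `G` is a sum of a sign-`s` and a sign-`¬s` member of `G`, (orth)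
`G` is isotropic, (jump) for every `x₀` some member of `G` is NOT congruent modulo `Z` to a multiple of `x₀`, and
(bound) two mutually orthogonal sign-`¬s` elements, the first outside `Z`, are proportional modulo `Z` — then some
sign-`s` member of `G` lies outside `Z`. Proof: otherwise `G ≡ G^{¬s} (mod Z)`; pick `x ∈ G` off `Z`, so its
`¬s`-part `x₂ ∉ Z`; by (jump) some `y ∈ G` is off the line of `x₂` mod `Z`, but its `¬s`-part is proportional to
`x₂` mod `Z` by (bound) — contradiction. [cite: McCallumLMS1991, Lemma 5.3 (proof, p. 303)] -/
theorem exists_eigen_not_mem_of_jump {H : Type*} [AddCommGroup H] (Z : AddSubgroup H) (InG : H → Prop)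
    (E : Bool → H → Prop) (orth : H → H → Prop) (s : Bool)
    (hdec : ∀ x, InG x → ∃ y z, InG y ∧ E s y ∧ InG z ∧ E (!s) z ∧ x = y + z)
    (horth : ∀ x y, InG x → InG y → orth x y)
    (hjump : ∀ x₀ : H, ∃ x, InG x ∧ ∀ a : ℤ, x - a • x₀ ∉ Z)
    (hbound : ∀ x y, E (!s) x → E (!s) y → orth x x → orth x y → orth y x → orth y y → x ∉ Z →
      ∃ a : ℤ, y - a • x ∈ Z) :
    ∃ x, InG x ∧ E s x ∧ x ∉ Z := by
  by_contra! hall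
  obtain ⟨x, hxG, hx⟩ := hjump 0
  have hx0 : x ∉ Z := by simpa using hx 0
  obtain ⟨x₁, x₂, hx₁G, hx₁E, hx₂G, hx₂E, rfl⟩ := hdec x hxG
  have hx₁Z : x₁ ∈ Z := hall x₁ hx₁G hx₁E
  have hx₂Z : x₂ ∉ Z := fun h ↦ hx0 (Z.add_mem hx₁Z h)
  obtain ⟨y, hyG, hy⟩ := hjump x₂
  obtain ⟨y₁, y₂, hy₁G, hy₁E, hy₂G, hy₂E, rfl⟩ := hdec y hyG
  have hy₁Z : y₁ ∈ Z := hall y₁ hy₁G hy₁E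
  obtain ⟨a, ha⟩ := hbound x₂ y₂ hx₂E hy₂E (horth _ _ hx₂G hx₂G) (horth _ _ hx₂G hy₂G)
    (horth _ _ hy₂G hx₂G) (horth _ _ hy₂G hy₂G) hx₂Z
  refine hy a ?_
  have h : y₁ + y₂ - a • x₂ = y₁ + (y₂ - a • x₂) := by abel
  rw [h]
  exact Z.add_mem hy₁Z ha

/-! ## §2 The (Supply) binder of the S2-ENGINE capstone from (J), (Stab), (IsoBound) -/

open WeierstrassCurve NumberField IsDedekindDomain
  Literature.NumberTheory.EllipticCurves Literature.NumberTheory.EllipticCurves.ModularForms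
  Literature.NumberTheory.GaloisRepresentations Module
open Summit.BirchSwinnertonDyer.Rank1Residual.X11b.Three.Koly.Method2

variable (W : WeierstrassCurve ℚ) (K : Type) [Field K] [NumberField K]
variable [W.IsElliptic] [W.IsGloballyMinimal] (ι : K →+* ℂ) (c : K ≃ₐ[ℚ] K)
  [Module (ZMod 3) (V3 W K)]
  [∀ v : Place K, Module (ZMod 3)
    (galoisCohomology (((W.baseChange K).torsionGaloisModule ((3 ^ 1 : ℕ) : ℤ)).toLocal v) 1)]

/-- **The capstone's (Supply) binder, SIGNED, from the unsigned jump.** Data as in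
`Method2.inductionOfLevelSystems_of_localGlobal`: the genuine localisations `loc` (`hloc`), the places `plK` of the
Kolyvagin primes, bilinear local forms `b` with (REC) `hrec` and the isotropies `hisoKum` ∕ `hisoOrd` ∕ `hisoTr` —
all VERBATIM the capstone's binders — and complex conjugation `c` with `c² = 1`. New hypotheses, for every good
non-empty level `n`, Kolyvagin prime `ℓ ∉ T`: (Stab) `hstab` — the relaxed group `G(n, ℓ, T)` (Kummer at `∞` and at
the finite `v ≠ λ` off `T` above no prime of `n`, ordinary above `n`, transverse on `T`, free at `λ = plK ℓ`) is
`conjAct c`-stable; (J) `hjump` — for every `x₀` some `x ∈ G` has `loc_λ x ∉ ℤ · loc_λ x₀` (stated through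
`torsionLocalKer_λ = ker loc_λ`); (IsoBound) `hbound` — at every Kolyvagin `λ` and sign `s`, two classes of sign `s`
whose localisations are mutually and self `b_λ`-orthogonal, the first with `loc_λ ≠ 0`, have proportional
localisations. CONCLUSION: the binder `hSupply` verbatim — for each sign a NON-ZERO class of that sign in `G`.
[cite: WZhang2014, Lemma 8.2] [cite: McCallumLMS1991, Prop. 2.1, Lemma 5.3] [cite: GrossLMS1991, Prop. 8.1] -/
theorem supply_signed_of_jump (hc2 : c * c = 1)
    (loc : (v : Place K) → V3 W K →ₗ[ZMod 3]
      galoisCohomology (((W.baseChange K).torsionGaloisModule ((3 ^ 1 : ℕ) : ℤ)).toLocal v) 1)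
    (hloc : ∀ (v : Place K) (x : V3 W K),
      loc v x = galoisCohomology.localization ((W.baseChange K).torsionGaloisModule ((3 ^ 1 : ℕ) : ℤ)) v 1 x)
    (plK : {ℓ // Zhang2014.IsKolyvaginPrime (W.conductorNorm ℤ) W K 3 ℓ} → HeightOneSpectrum (𝓞 K))
    (b : (v : Place K) →
      galoisCohomology (((W.baseChange K).torsionGaloisModule ((3 ^ 1 : ℕ) : ℤ)).toLocal v) 1 →ₗ[ZMod 3]
      galoisCohomology (((W.baseChange K).torsionGaloisModule ((3 ^ 1 : ℕ) : ℤ)).toLocal v) 1 →ₗ[ZMod 3] ZMod 3)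
    (hrec : ∀ (x y : V3 W K) (T : Finset (Place K)), (∀ v, v ∉ T → b v (loc v x) (loc v y) = 0) →
      ∑ v ∈ T, b v (loc v x) (loc v y) = 0)
    (hisoKum : ∀ (v : Place K),
      ∀ x ∈ (W.baseChange K).kummerLocalConditionAt ((3 ^ 1 : ℕ) : ℤ) (Place.Completion v),
      ∀ y ∈ (W.baseChange K).kummerLocalConditionAt ((3 ^ 1 : ℕ) : ℤ) (Place.Completion v), b v x y = 0)
    (hisoOrd : ∀ (v : HeightOneSpectrum (𝓞 K)) (x y : V3 W K),
      x ∈ (W.baseChange K).ordinaryLocalKer (v.adicCompletion K) ((3 ^ 1 : ℕ) : ℤ) →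
      y ∈ (W.baseChange K).ordinaryLocalKer (v.adicCompletion K) ((3 ^ 1 : ℕ) : ℤ) →
      b (Sum.inr v) (loc (Sum.inr v) x) (loc (Sum.inr v) y) = 0)
    (hisoTr : ∀ (ℓ : {ℓ // Zhang2014.IsKolyvaginPrime (W.conductorNorm ℤ) W K 3 ℓ}) (x y : V3 W K),
      x ∈ transverseLocalKer W K ι ℓ (plK ℓ) → y ∈ transverseLocalKer W K ι ℓ (plK ℓ) →
      b (Sum.inr (plK ℓ)) (loc (Sum.inr (plK ℓ)) x) (loc (Sum.inr (plK ℓ)) y) = 0)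
    -- (Stab): the relaxed group `G(n, ℓ, T)` is stable under complex conjugation
    (hstab : ∀ (n : Finset {q // IsUAdmissiblePrime W K q}), GoodLevel W K n → n.Nonempty →
      ∀ (ℓ : {ℓ // Zhang2014.IsKolyvaginPrime (W.conductorNorm ℤ) W K 3 ℓ}) (T : Finset _), ℓ ∉ T →
      ∀ x : V3 W K,
        ((∀ w : InfinitePlace K, x ∈ selmerLocalKer (W.baseChange K) w.Completion ((3 ^ 1 : ℕ) : ℤ)) ∧
          (∀ v : HeightOneSpectrum (𝓞 K), v ≠ plK ℓ → (∀ ℓ' ∈ T, plK ℓ' ≠ v) →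
            ((∀ q ∈ n, ((q : ℕ) : 𝓞 K) ∉ v.asIdeal) →
              x ∈ selmerLocalKer (W.baseChange K) (v.adicCompletion K) ((3 ^ 1 : ℕ) : ℤ)) ∧
            (∀ q ∈ n, ((q : ℕ) : 𝓞 K) ∈ v.asIdeal →
              x ∈ (W.baseChange K).ordinaryLocalKer (v.adicCompletion K) ((3 ^ 1 : ℕ) : ℤ))) ∧
          (∀ ℓ' ∈ T, x ∈ transverseLocalKer W K ι ℓ' (plK ℓ'))) →
        ((∀ w : InfinitePlace K,
            conjAct W c ((3 ^ 1 : ℕ) : ℤ) x ∈ selmerLocalKer (W.baseChange K) w.Completion ((3 ^ 1 : ℕ) : ℤ)) ∧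
          (∀ v : HeightOneSpectrum (𝓞 K), v ≠ plK ℓ → (∀ ℓ' ∈ T, plK ℓ' ≠ v) →
            ((∀ q ∈ n, ((q : ℕ) : 𝓞 K) ∉ v.asIdeal) →
              conjAct W c ((3 ^ 1 : ℕ) : ℤ) x ∈
                selmerLocalKer (W.baseChange K) (v.adicCompletion K) ((3 ^ 1 : ℕ) : ℤ)) ∧
            (∀ q ∈ n, ((q : ℕ) : 𝓞 K) ∈ v.asIdeal →
              conjAct W c ((3 ^ 1 : ℕ) : ℤ) x ∈
                (W.baseChange K).ordinaryLocalKer (v.adicCompletion K) ((3 ^ 1 : ℕ) : ℤ))) ∧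
          (∀ ℓ' ∈ T, conjAct W c ((3 ^ 1 : ℕ) : ℤ) x ∈ transverseLocalKer W K ι ℓ' (plK ℓ'))))
    -- (J): the image of `G(n, ℓ, T)` at `λ` is not contained in a line
    (hjump : ∀ (n : Finset {q // IsUAdmissiblePrime W K q}), GoodLevel W K n → n.Nonempty →
      ∀ (ℓ : {ℓ // Zhang2014.IsKolyvaginPrime (W.conductorNorm ℤ) W K 3 ℓ}) (T : Finset _), ℓ ∉ T →
      ∀ x₀ : V3 W K, ∃ x : V3 W K,
        ((∀ w : InfinitePlace K, x ∈ selmerLocalKer (W.baseChange K) w.Completion ((3 ^ 1 : ℕ) : ℤ)) ∧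
          (∀ v : HeightOneSpectrum (𝓞 K), v ≠ plK ℓ → (∀ ℓ' ∈ T, plK ℓ' ≠ v) →
            ((∀ q ∈ n, ((q : ℕ) : 𝓞 K) ∉ v.asIdeal) →
              x ∈ selmerLocalKer (W.baseChange K) (v.adicCompletion K) ((3 ^ 1 : ℕ) : ℤ)) ∧
            (∀ q ∈ n, ((q : ℕ) : 𝓞 K) ∈ v.asIdeal →
              x ∈ (W.baseChange K).ordinaryLocalKer (v.adicCompletion K) ((3 ^ 1 : ℕ) : ℤ))) ∧
          (∀ ℓ' ∈ T, x ∈ transverseLocalKer W K ι ℓ' (plK ℓ'))) ∧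
        ∀ a : ℤ, x - a • x₀ ∉ (W.baseChange K).torsionLocalKer ((plK ℓ).adicCompletion K) ((3 ^ 1 : ℕ) : ℤ))
    -- (IsoBound): at a Kolyvagin prime, mutually isotropic localisations of one sign are proportional
    (hbound : ∀ (ℓ : {ℓ // Zhang2014.IsKolyvaginPrime (W.conductorNorm ℤ) W K 3 ℓ}) (s : Bool) (x y : V3 W K),
      conjAct W c ((3 ^ 1 : ℕ) : ℤ) x = sgn s • x → conjAct W c ((3 ^ 1 : ℕ) : ℤ) y = sgn s • y →
      b (Sum.inr (plK ℓ)) (loc (Sum.inr (plK ℓ)) x) (loc (Sum.inr (plK ℓ)) x) = 0 →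
      b (Sum.inr (plK ℓ)) (loc (Sum.inr (plK ℓ)) x) (loc (Sum.inr (plK ℓ)) y) = 0 →
      b (Sum.inr (plK ℓ)) (loc (Sum.inr (plK ℓ)) y) (loc (Sum.inr (plK ℓ)) x) = 0 →
      b (Sum.inr (plK ℓ)) (loc (Sum.inr (plK ℓ)) y) (loc (Sum.inr (plK ℓ)) y) = 0 →
      x ∉ (W.baseChange K).torsionLocalKer ((plK ℓ).adicCompletion K) ((3 ^ 1 : ℕ) : ℤ) →
      ∃ a : ℤ, y - a • x ∈ (W.baseChange K).torsionLocalKer ((plK ℓ).adicCompletion K) ((3 ^ 1 : ℕ) : ℤ)) :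
    ∀ (n : Finset {q // IsUAdmissiblePrime W K q}), GoodLevel W K n → n.Nonempty →
      ∀ (ℓ : {ℓ // Zhang2014.IsKolyvaginPrime (W.conductorNorm ℤ) W K 3 ℓ}) (T : Finset _), ℓ ∉ T →
      ∀ s : Bool, ∃ x : V3 W K, conjAct W c ((3 ^ 1 : ℕ) : ℤ) x = sgn s • x ∧ x ≠ 0 ∧
        (∀ w : InfinitePlace K, x ∈ selmerLocalKer (W.baseChange K) w.Completion ((3 ^ 1 : ℕ) : ℤ)) ∧
        (∀ v : HeightOneSpectrum (𝓞 K), v ≠ plK ℓ → (∀ ℓ' ∈ T, plK ℓ' ≠ v) →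
          ((∀ q ∈ n, ((q : ℕ) : 𝓞 K) ∉ v.asIdeal) →
            x ∈ selmerLocalKer (W.baseChange K) (v.adicCompletion K) ((3 ^ 1 : ℕ) : ℤ)) ∧
          (∀ q ∈ n, ((q : ℕ) : 𝓞 K) ∈ v.asIdeal →
            x ∈ (W.baseChange K).ordinaryLocalKer (v.adicCompletion K) ((3 ^ 1 : ℕ) : ℤ))) ∧
        (∀ ℓ' ∈ T, x ∈ transverseLocalKer W K ι ℓ' (plK ℓ')) := by
  intro n hg hn ℓ T hℓT s
  -- the relaxed group `G = G(n, ℓ, T)` as a subgroup of `H¹(K, E[3])`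
  let G : AddSubgroup (V3 W K) :=
    { carrier := {x | (∀ w : InfinitePlace K, x ∈ selmerLocalKer (W.baseChange K) w.Completion ((3 ^ 1 : ℕ) : ℤ)) ∧
        (∀ v : HeightOneSpectrum (𝓞 K), v ≠ plK ℓ → (∀ ℓ' ∈ T, plK ℓ' ≠ v) →
          ((∀ q ∈ n, ((q : ℕ) : 𝓞 K) ∉ v.asIdeal) →
            x ∈ selmerLocalKer (W.baseChange K) (v.adicCompletion K) ((3 ^ 1 : ℕ) : ℤ)) ∧
          (∀ q ∈ n, ((q : ℕ) : 𝓞 K) ∈ v.asIdeal →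
            x ∈ (W.baseChange K).ordinaryLocalKer (v.adicCompletion K) ((3 ^ 1 : ℕ) : ℤ))) ∧
        (∀ ℓ' ∈ T, x ∈ transverseLocalKer W K ι ℓ' (plK ℓ'))}
      add_mem' := fun {x y} hx hy ↦
        ⟨fun w ↦ add_mem (hx.1 w) (hy.1 w),
          fun v hv hvT ↦ ⟨fun hq ↦ add_mem ((hx.2.1 v hv hvT).1 hq) ((hy.2.1 v hv hvT).1 hq),
            fun q hq hqv ↦ add_mem ((hx.2.1 v hv hvT).2 q hq hqv) ((hy.2.1 v hv hvT).2 q hq hqv)⟩,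
          fun ℓ' hℓ' ↦ add_mem (hx.2.2 ℓ' hℓ') (hy.2.2 ℓ' hℓ')⟩
      zero_mem' :=
        ⟨fun w ↦ zero_mem _, fun v _ _ ↦ ⟨fun _ ↦ zero_mem _, fun _ _ _ ↦ zero_mem _⟩, fun _ _ ↦ zero_mem _⟩
      neg_mem' := fun {x} hx ↦
        ⟨fun w ↦ neg_mem (hx.1 w),
          fun v hv hvT ↦ ⟨fun hq ↦ neg_mem ((hx.2.1 v hv hvT).1 hq),
            fun q hq hqv ↦ neg_mem ((hx.2.1 v hv hvT).2 q hq hqv)⟩,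
          fun ℓ' hℓ' ↦ neg_mem (hx.2.2 ℓ' hℓ')⟩ }
  -- the strict subgroup at `λ` (= `ker loc_λ`) and the Kummer dictionary
  set Z := (W.baseChange K).torsionLocalKer ((plK ℓ).adicCompletion K) ((3 ^ 1 : ℕ) : ℤ) with hZdef
  have hZero : ∀ x : V3 W K, x ∈ Z ↔ loc (Sum.inr (plK ℓ)) x = 0 := by
    intro x; rw [hloc]; exact mem_torsionLocalKer_iff_localization_eq_zero W K (plK ℓ) x
  have hKumFin : ∀ (v : HeightOneSpectrum (𝓞 K)) (x : V3 W K),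
      x ∈ selmerLocalKer (W.baseChange K) (v.adicCompletion K) ((3 ^ 1 : ℕ) : ℤ) →
        loc (Sum.inr v) x ∈
          (W.baseChange K).kummerLocalConditionAt ((3 ^ 1 : ℕ) : ℤ) (Place.Completion (Sum.inr v : Place K)) := by
    intro v x hx; rw [hloc]; exact (mem_selmerLocalKer_iff_localization_mem_kummer W K v x).mp hx
  have hKumInf : ∀ (w : InfinitePlace K) (x : V3 W K),
      x ∈ selmerLocalKer (W.baseChange K) w.Completion ((3 ^ 1 : ℕ) : ℤ) →
        loc (Sum.inl w) x ∈
          (W.baseChange K).kummerLocalConditionAt ((3 ^ 1 : ℕ) : ℤ) (Place.Completion (Sum.inl w : Place K)) := by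
    intro w x hx; rw [hloc]; exact (mem_selmerLocalKer_iff_localization_mem_kummer_inf W K w x).mp hx
  -- (orth): `loc_λ(G)` is isotropic — reciprocity with all terms off `λ` vanishing
  have horth : ∀ x y : V3 W K, x ∈ G → y ∈ G →
      b (Sum.inr (plK ℓ)) (loc (Sum.inr (plK ℓ)) x) (loc (Sum.inr (plK ℓ)) y) = 0 := by
    intro x y hx hy
    have h := hrec x y {(Sum.inr (plK ℓ) : Place K)} fun v hv ↦ ?_
    · rwa [Finset.sum_singleton] at h
    have hv' : v ≠ Sum.inr (plK ℓ) := fun h ↦ hv (Finset.mem_singleton.mpr h)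
    rcases v with w | v
    · exact hisoKum (Sum.inl w) _ (hKumInf w x (hx.1 w)) _ (hKumInf w y (hy.1 w))
    · have hvℓ : v ≠ plK ℓ := fun h ↦ hv' (by rw [h])
      by_cases hvT : ∃ ℓ' ∈ T, plK ℓ' = v
      · obtain ⟨ℓ', hℓ'T, rfl⟩ := hvT
        exact hisoTr ℓ' x y (hx.2.2 ℓ' hℓ'T) (hy.2.2 ℓ' hℓ'T)
      · push Not at hvT
        by_cases hq : ∃ q ∈ n, ((q : ℕ) : 𝓞 K) ∈ v.asIdeal
        · obtain ⟨q, hq, hqv⟩ := hq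
          exact hisoOrd v x y ((hx.2.1 v hvℓ hvT).2 q hq hqv) ((hy.2.1 v hvℓ hvT).2 q hq hqv)
        · push Not at hq
          exact hisoKum (Sum.inr v) _ (hKumFin v x ((hx.2.1 v hvℓ hvT).1 hq)) _
            (hKumFin v y ((hy.2.1 v hvℓ hvT).1 hq))
  -- (dec): eigen-decomposition inside the `conjAct`-stable subgroup `G` (`3` odd, `c² = 1`)
  have h3 : ∀ a : V3 W K, 3 • a = 0 := fun a ↦ by
    rw [← Nat.cast_smul_eq_nsmul (ZMod 3), ZMod.natCast_self, zero_smul]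
  have hτ : ∀ a : V3 W K, conjAct W c ((3 ^ 1 : ℕ) : ℤ) (conjAct W c ((3 ^ 1 : ℕ) : ℤ) a) = a :=
    fun a ↦ conjAct_conjAct_of_mul_self W hc2 _ a
  have hG : ∀ a ∈ G, conjAct W c ((3 ^ 1 : ℕ) : ℤ) a ∈ G := fun a ha ↦ hstab n hg hn ℓ T hℓT a ha
  have hsgn : sgn s = 1 ∨ sgn s = -1 := by cases s <;> simp [sgn]
  have hsgn' : sgn (!s) = -sgn s := by cases s <;> rfl
  have hdec : ∀ x, x ∈ G → ∃ y z, y ∈ G ∧ conjAct W c ((3 ^ 1 : ℕ) : ℤ) y = sgn s • y ∧ z ∈ G ∧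
      conjAct W c ((3 ^ 1 : ℕ) : ℤ) z = sgn (!s) • z ∧ x = y + z := by
    intro x hx
    obtain ⟨y, hy, z, hz, hyτ, hzτ, hxyz⟩ :=
      exists_eigen_decomposition (n := 3) (by decide) h3 (conjAct W c ((3 ^ 1 : ℕ) : ℤ)) hτ hsgn G hG hx
    exact ⟨y, z, hy, hyτ, hz, by rw [hsgn']; exact hzτ, hxyz⟩
  -- assemble
  obtain ⟨x, hxG, hxE, hxZ⟩ := exists_eigen_not_mem_of_jump Z (· ∈ G)
    (fun s' x ↦ conjAct W c ((3 ^ 1 : ℕ) : ℤ) x = sgn s' • x)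
    (fun x y ↦ b (Sum.inr (plK ℓ)) (loc (Sum.inr (plK ℓ)) x) (loc (Sum.inr (plK ℓ)) y) = 0) s hdec horth
    (fun x₀ ↦ hjump n hg hn ℓ T hℓT x₀) (fun x y hx hy ↦ hbound ℓ (!s) x y hx hy)
  refine ⟨x, hxE, fun h0 ↦ hxZ (h0 ▸ zero_mem Z), hxG.1, hxG.2.1, hxG.2.2⟩

end Summit.BirchSwinnertonDyer.Rank1Residual.X11b.Three.Koly.ZhangSupply

end
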